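import Summits.ResolutionOfSingularities.ResolutionOfSingularities.Theorems.KFibre
import Summits.ResolutionOfSingularities.ResolutionOfSingularities.Theorems.ShallowPort3
import Summits.ResolutionOfSingularities.ResolutionOfSingularities.Theorems.ForcedTowerClasses
import Literature.AlgebraicGeometry.Resolution.CoefficientDerivations

/-!
# KGener — transport of symbolic-power memberships along the `K`-thread (Layer D3 of the tower dictionary, ring side)

0-weight TOOL toward `TightDefectClasses.TowerDictionary` (decomp-res lens-5, g39; plan `NEXT-g40.md` §6 D3 = (ZN-gen)).
The ISOLATION field `ForcedWalk.isolated` of the model walk is produced from the tower's isolation `ForcedTower.isolated` by contradiction: a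
non-isolated `K`-stage has a prime `𝔓 ⊊ (Z,u)` of `K[Z,u]` with `Z^q + F ∈ 𝔓^{(q)}` (landed `IsoDict` / `IsoDict2`); this file carries such a
SYMBOLIC MEMBERSHIP `∃ s ∉ P, s·x ∈ Pⁿ` down the thread
`K[Z,u] → B̃_i = (B_i ⊗_k K)_𝔴 ← B_i ⊗_k K ← B_i ≅ 𝒪_{X_i,x_i}`:
§1 elementary transports (unit factors, ring isomorphisms); §2 up / down a localisation (`symb_map_of_disjoint`, `symb_under`); §3 down the base change
`B → B ⊗_k K` for `K/k` separable algebraic (`symb_under_tensor`, = landed `KFibre.algebraMap_mem_pow_maximalIdeal_iff` in symbolic form); §4 the prime so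
reached is NOT the closed point: a prime `𝔮 ⊆ 𝔴` of `B ⊗_k K` contracting to `𝔪_B` IS `𝔴` when `κ(B)/k` is algebraic (`eq_of_under_eq_maximalIdeal`, the fibre
`κ(B) ⊗_k K` is zero-dimensional); §5 the scheme end: a symbolic membership of the generator of `I_x` at a prime `P ≠ 𝔪_x` of `𝒪_{X,x}` yields
(landed `ShallowPort.exists_specializes_ne_le_idealOrder`) a generization `ζ ⤳ x`, `ζ ≠ x` of order `≥ n`, which defeats `ForcedTowerClasses.IsIsolatedIn`
(`not_isIsolatedIn_of_symb`) — for a forced tower: `False` (`ForcedTower.absurd_of_symb`).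
All PROVED, 0 sorry.  [cite: Matsumura1987, Thm. 4.1 / §6 (symbolic powers), Thm. 7.5, Thm. 9.3]; [cite: EGAIV2, Prop. 2.3.4].
-/

noncomputable section

set_option linter.dupNamespace false

namespace Summit.ResolutionOfSingularities.ResolutionOfSingularities.Theorems.KGener

open TensorProduct IsLocalRing

/-! ## §1 Elementary transports -/

section Elementary

variable {R R' : Type} [CommRing R] [CommRing R']

/-- Multiplying by a ring element keeps a symbolic membership. -/
theorem symb_mul_left (P : Ideal R) {n : ℕ} {x : R} (h : ∃ s ∉ P, s * x ∈ P ^ n) (v : R) :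
    ∃ s ∉ P, s * (v * x) ∈ P ^ n := by
  obtain ⟨s, hs, hsx⟩ := h
  refine ⟨s, hs, ?_⟩
  rw [mul_left_comm]
  exact Ideal.mul_mem_left _ v hsx

/-- Pull-back of a symbolic membership along a ring isomorphism. -/
theorem symb_comap_equiv (e : R ≃+* R') (Q : Ideal R') {n : ℕ} {x : R} (h : ∃ t ∉ Q, t * e x ∈ Q ^ n) :
    ∃ s ∉ Q.comap e, s * x ∈ (Q.comap e) ^ n := by
  obtain ⟨t, ht, htx⟩ := h
  refine ⟨e.symm t, ?_, ?_⟩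
  · rw [Ideal.mem_comap]
    intro h1
    apply ht
    have h2 : e (e.symm t) = t := e.apply_symm_apply t
    rwa [h2] at h1
  · rw [← Ideal.map_symm, ← Ideal.map_pow]
    have h1 : e.symm t * x = e.symm (t * e x) := by rw [map_mul, e.symm_apply_apply]
    rw [h1]
    exact Ideal.mem_map_of_mem _ htx

end Elementary

/-! ## §2 Up and down a localisation -/

section Localisation

variable {R S : Type} [CommRing R] [CommRing S] [Algebra R S] (M : Submonoid R) [IsLocalization M S]

include M in
/-- **UP**: a symbolic membership at a prime `P` disjoint from `M` extends to the prime `P·S` of the localisation. -/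
theorem symb_map_of_disjoint {P : Ideal R} (hP : P.IsPrime) (hd : Disjoint (M : Set R) P) {n : ℕ} {x : R}
    (h : ∃ s ∉ P, s * x ∈ P ^ n) :
    ∃ t ∉ P.map (algebraMap R S), t * algebraMap R S x ∈ (P.map (algebraMap R S)) ^ n := by
  obtain ⟨s, hs, hsx⟩ := h
  refine ⟨algebraMap R S s, ?_, ?_⟩
  · intro hmem
    apply hs
    have h1 : s ∈ (P.map (algebraMap R S)).under R := Ideal.mem_comap.mpr hmem
    rwa [IsLocalization.under_map_of_isPrime_disjoint M S hP hd] at h1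
  · rw [← map_mul, ← Ideal.map_pow]
    exact Ideal.mem_map_of_mem _ hsx

include M in
/-- **DOWN**: a symbolic membership at a prime `Q` of the localisation descends to `Q ∩ R`. -/
theorem symb_under {Q : Ideal S} [hQ : Q.IsPrime] {n : ℕ} {x : R} (h : ∃ t ∉ Q, t * algebraMap R S x ∈ Q ^ n) :
    ∃ s ∉ Q.under R, s * x ∈ (Q.under R) ^ n := by
  obtain ⟨t, ht, htx⟩ := h
  obtain ⟨⟨a, m⟩, rfl⟩ := IsLocalization.mk'_surjective M t
  have hQ' : (Q.under R).map (algebraMap R S) = Q := IsLocalization.map_under M (S := S) Q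
  rw [← hQ', ← Ideal.map_pow, IsLocalization.mem_map_algebraMap_iff M S] at htx
  obtain ⟨⟨⟨c, hc⟩, m'⟩, h1⟩ := htx
  have h2 : algebraMap R S (a * x * m') = algebraMap R S (c * m) := by
    rw [map_mul, map_mul, map_mul, ← h1, ← IsLocalization.mk'_spec S a m]
    ring
  obtain ⟨c', hc'⟩ := (IsLocalization.eq_iff_exists M S).mp h2
  have hunit : ∀ y : M, (y : R) ∉ Q.under R := fun y hy =>
    hQ.ne_top (Q.eq_top_of_isUnit_mem (Ideal.mem_comap.mp hy) (IsLocalization.map_units S y))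
  have ha : a ∉ Q.under R := fun ha' => ht (IsLocalization.mk'_mem_iff.mpr (Ideal.mem_comap.mp ha'))
  refine ⟨(c' : R) * (m' : R) * a, ?_, ?_⟩
  · intro hmem
    rcases (Ideal.IsPrime.under R Q).mem_or_mem hmem with h3 | h3
    · rcases (Ideal.IsPrime.under R Q).mem_or_mem h3 with h4 | h4
      · exact hunit c' h4
      · exact hunit m' h4
    · exact ha h3
  · have h3 : (c' : R) * (m' : R) * a * x = (c' : R) * (a * x * m') := by ring
    rw [h3, hc']
    exact Ideal.mul_mem_left _ _ (Ideal.mul_mem_right _ _ hc)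

end Localisation

/-! ## §3 Down the separable base change `B → B ⊗_k K` -/

section Tensor

variable (k K : Type) [Field k] [Field K] [Algebra k K] [Algebra.IsSeparable k K] (B : Type) [CommRing B] [Algebra k B]

/-- **DOWN THE BASE CHANGE** (`K/k` separable algebraic): a symbolic membership of `b ⊗ 1` at a prime `𝔮` of `B ⊗_k K` descends to `b` at `𝔮 ∩ B`
— the symbolic form of landed `KFibre.algebraMap_mem_pow_maximalIdeal_iff` (`𝔮^(n) ∩ B = (𝔮 ∩ B)^(n)`). [cite: Matsumura1987, Thm. 7.5, Thm. 9.3] -/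
theorem symb_under_tensor (𝔮 : Ideal (B ⊗[k] K)) [𝔮.IsPrime] {n : ℕ} {b : B}
    (h : ∃ t ∉ 𝔮, t * algebraMap B (B ⊗[k] K) b ∈ 𝔮 ^ n) :
    ∃ s ∉ 𝔮.comap (algebraMap B (B ⊗[k] K)), s * b ∈ (𝔮.comap (algebraMap B (B ⊗[k] K))) ^ n :=
  (Literature.AlgebraicGeometry.Resolution.CoeffDerivation.exists_mul_mem_pow_iff_algebraMap_mem (𝔮.comap (algebraMap B (B ⊗[k] K)))
      (Localization.AtPrime (𝔮.comap (algebraMap B (B ⊗[k] K)))) b n).mpr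
    ((KFibre.algebraMap_mem_pow_maximalIdeal_iff k K B 𝔮 n b).mpr
      ((Literature.AlgebraicGeometry.Resolution.CoeffDerivation.exists_mul_mem_pow_iff_algebraMap_mem 𝔮 (Localization.AtPrime 𝔮) _ n).mp h))

end Tensor

/-! ## §4 The fibre over the closed point is zero-dimensional -/

section Fibre

variable (k K : Type) [Field k] [Field K] [Algebra k K] (B : Type) [CommRing B] [IsLocalRing B] [Algebra k B]
  [Algebra.IsAlgebraic k (ResidueField B)]

/-- **A prime `𝔮 ⊆ 𝔴` of `B ⊗_k K` contracting to `𝔪_B` is `𝔴`** (`κ(B)/k` algebraic: `(B ⊗_k K)/𝔮` is a domain algebraic over the field `K`, hence a field).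
So the generization reached by §2–§3 from a prime `≠ 𝔪̃` of `B̃` is a prime `≠ 𝔪_B` of `B`. [cite: EGAIV2, Prop. 2.3.4] -/
theorem eq_of_under_eq_maximalIdeal {W 𝔮 : Ideal (B ⊗[k] K)} (hW : W ≠ ⊤) [h𝔮 : 𝔮.IsPrime] (hle : 𝔮 ≤ W)
    (hunder : 𝔮.comap (algebraMap B (B ⊗[k] K)) = maximalIdeal B) : 𝔮 = W := by
  letI algK : Algebra K (B ⊗[k] K) := (Algebra.TensorProduct.includeRight : K →ₐ[k] B ⊗[k] K).toRingHom.toAlgebra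
  have halgK : ∀ a : K, algebraMap K (B ⊗[k] K) a = (1 : B) ⊗ₜ[k] a := fun a => rfl
  -- the two structure maps agree on `k`
  have hcomp : (algebraMap K (B ⊗[k] K ⧸ 𝔮)).comp (algebraMap k K) =
      ((Ideal.Quotient.mk 𝔮).comp (algebraMap B (B ⊗[k] K))).comp (algebraMap k B) := by
    refine RingHom.ext fun c => ?_
    rw [RingHom.comp_apply, RingHom.comp_apply, RingHom.comp_apply, ← Ideal.Quotient.mk_algebraMap, halgK,
      Algebra.TensorProduct.algebraMap_apply, Algebra.algebraMap_self, RingHom.id_apply, Algebra.algebraMap_eq_smul_one,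
      Algebra.algebraMap_eq_smul_one, TensorProduct.tmul_smul, TensorProduct.smul_tmul']
  -- every `b ⊗ 1` is integral over `K` modulo `𝔮`
  have hint1 : ∀ b : B, IsIntegral K (Ideal.Quotient.mk 𝔮 (b ⊗ₜ[k] (1 : K))) := by
    intro b
    obtain ⟨P, hP0, hP⟩ := (Algebra.IsAlgebraic.isAlgebraic (R := k) (residue B b))
    have hPB : Polynomial.aeval b P ∈ maximalIdeal B := by
      rw [← residue_eq_zero_iff, Polynomial.aeval_def, Polynomial.hom_eval₂]
      change Polynomial.eval₂ (algebraMap k (ResidueField B)) (residue B b) P = 0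
      rw [← Polynomial.aeval_def]
      exact hP
    rw [← hunder, Ideal.mem_comap, Polynomial.aeval_def] at hPB
    have hP' : P.map (algebraMap k K) ≠ 0 := (Polynomial.map_ne_zero_iff (algebraMap k K).injective).mpr hP0
    refine IsAlgebraic.isIntegral ⟨P.map (algebraMap k K), hP', ?_⟩
    have hb : (b ⊗ₜ[k] (1 : K)) = algebraMap B (B ⊗[k] K) b := by
      rw [Algebra.TensorProduct.algebraMap_apply, Algebra.algebraMap_self, RingHom.id_apply]
    rw [Polynomial.aeval_def, Polynomial.eval₂_map, hcomp, hb, ← RingHom.comp_apply (Ideal.Quotient.mk 𝔮) (algebraMap B (B ⊗[k] K)) b,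
      ← Polynomial.hom_eval₂, RingHom.comp_apply, Ideal.Quotient.eq_zero_iff_mem]
    exact hPB
  -- hence `(B ⊗ K)/𝔮` is integral over `K`
  haveI hint : Algebra.IsIntegral K (B ⊗[k] K ⧸ 𝔮) := by
    refine ⟨fun y => ?_⟩
    obtain ⟨z, rfl⟩ := Ideal.Quotient.mk_surjective y
    induction z using TensorProduct.induction_on with
    | zero =>
      rw [map_zero]
      exact isIntegral_zero
    | tmul b a =>
      have h1 : b ⊗ₜ[k] a = algebraMap K (B ⊗[k] K) a * (b ⊗ₜ[k] (1 : K)) := by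
        rw [halgK, Algebra.TensorProduct.tmul_mul_tmul, one_mul, mul_one]
      rw [h1, map_mul, Ideal.Quotient.mk_algebraMap]
      exact isIntegral_algebraMap.mul (hint1 b)
    | add x y hx hy =>
      rw [map_add]
      exact hx.add hy
  have hfield : IsField (B ⊗[k] K ⧸ 𝔮) := isField_of_isIntegral_of_isField' (R := K) (Field.toIsField K)
  have hmax : 𝔮.IsMaximal := Ideal.Quotient.maximal_of_isField 𝔮 hfield
  exact hmax.eq_of_le hW hle

end Fibre

/-! ## §5 The scheme end: generizations of order `≥ n` defeat isolation -/

section SchemeEnd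

open CategoryTheory AlgebraicGeometry Literature.AlgebraicGeometry.Resolution
open Summit.ResolutionOfSingularities.ResolutionOfSingularities.Theorems.ForcedTowerClasses

/-- **A symbolic membership at a non-closed prime defeats isolation.**  `I_x = (f)`, `P ≠ 𝔪_x` prime of `𝒪_{X,x}`, `s·f ∈ Pⁿ` for some `s ∉ P`, and `S ⊇ {ord ≥ n}`:
then `x` is not an isolated point of `S` (the generization `ζ ⤳ x` of `ShallowPort.exists_specializes_ne_le_idealOrder` lies in every open neighbourhood of `x`).
[cite: StacksProject, Tag 01J7] -/
theorem not_isIsolatedIn_of_symb {X : Scheme.{0}} {x : X} (I : X.IdealSheafData) {f : X.presheaf.stalk x}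
    (hf : stalkIdeal I x = Ideal.span {f}) (P : Ideal (X.presheaf.stalk x)) [P.IsPrime] (hP : P ≠ maximalIdeal (X.presheaf.stalk x))
    {n : ℕ} (h : ∃ s ∉ P, s * f ∈ P ^ n) {S : Set X} (hS : ∀ ζ : X, ((n : ℕ) : ℕ∞) ≤ idealOrder I ζ → ζ ∈ S) :
    ¬ IsIsolatedIn S x := by
  rintro ⟨-, U, hxU, hU⟩
  obtain ⟨s, hs, hsf⟩ := h
  obtain ⟨ζ, hζx, hne, hord⟩ := ShallowPort.exists_specializes_ne_le_idealOrder I hf P hP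
    (CoeffDerivation.algebraMap_mem_maximalIdeal_pow_of_mul_mem P (Localization.AtPrime P) hs hsf)
  exact hne (hU ⟨hζx.mem_open U.2 hxU, hS ζ hord⟩)

/-- **For a forced tower**: a symbolic membership `s·f ∈ P^{μ}` (`s ∉ P`) of the generator `f` of `(D i)_x` at a prime `P ≠ 𝔪` of `𝒪_{X_i, x_i}` is absurd —
the tower's point `x_i` is an isolated point of `supp (D i) = {ord ≥ μ}` (`ForcedTower.isolated`). -/
theorem ForcedTower.absurd_of_symb (T : ForcedTower) (i : ℕ) {f : (T.St i).presheaf.stalk (T.pt i)}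
    (hf : stalkIdeal (T.D i).ideal (T.pt i) = Ideal.span {f}) (P : Ideal ((T.St i).presheaf.stalk (T.pt i))) [P.IsPrime]
    (hP : P ≠ maximalIdeal ((T.St i).presheaf.stalk (T.pt i))) (h : ∃ s ∉ P, s * f ∈ P ^ (T.D i).mult) : False :=
  not_isIsolatedIn_of_symb (T.D i).ideal hf P hP h (S := (T.D i).support) (fun _ hζ => hζ) (T.isolated i)

end SchemeEnd

end Summit.ResolutionOfSingularities.ResolutionOfSingularities.Theorems.KGener
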